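import Summits.RiemannHypothesis.RiemannHypothesis.Theses.WeilComb
import Summits.RiemannHypothesis.RiemannHypothesis.Theorems.FejerDivisorPositivity
import Summits.RiemannHypothesis.RiemannHypothesis.Theorems.WeilCombCombShapePositivityStubReductionLocal
import Summits.RiemannHypothesis.RiemannHypothesis.Theorems.WeilCombCombShapePositivityStubTwoPrimeCollapse
import Summits.RiemannHypothesis.RiemannHypothesis.Theorems.WeilCombCombShapePositivityStubSymbolExpSum
import Literature.NumberTheory.LFunctions.WeilExplicit
import Literature.NumberTheory.LFunctions.WeilMellinBounds

/-!
# The de-arithmetised (Bochner) form of `FejerDivisorPositivity`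
(crux `WeilComb.CombShapePositivity`, item stmt-RiemannHypothesis-11229, stub-plan `STUB-PLAN-stub_fejer.md`,
tier T5e; sprove seat)

`FejerDivisorPositivity` — the RH-equivalent crux "Fejér divisor-sum positivity", i.e. the registered stub
`stub_fejer` of line `Sketch` — says exactly that the comb symbol `w_ε(x) = W(τ_x(φ_ε ⋆ φ̃_ε))` is a function
of POSITIVE TYPE on `ℝ` for every `ε > 0`: its Hermitian node forms `Σ_{i,j} c_i conj(c_j) w_ε(x_i − x_j)` are
`≥ 0` at arbitrary real nodes. `⇐`: the Fejér face of `(S, n, θ)` is the node form at the nodes `log d`,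
`d ∣ ∏_{p∈S} p^n`, with coefficients `χ_θ(d)`. `⇒`: by the S-local product-vector reduction `reduction_local`
(`n₀ = 0`, `S = {2, 3}`) the faces give the node forms at all `{2,3}`-smooth integer nodes, and
`psd_of_psd_smooth` (density of `ℤ log 2 + ℤ log 3`, continuity of the symbol `continuous_symbol`) passes
to arbitrary real nodes. By Bochner's theorem this is the statement that `w_ε` is the Fourier transform of a
positive measure — under RH the smoothed zero measure `Σ_γ m |Φ₀(εγ)|² δ_γ`.
-/

noncomputable section

-- the sub-problem path RiemannHypothesis/RiemannHypothesis duplicates a namespace (D-0017)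
set_option linter.dupNamespace false

open scoped BigOperators ComplexConjugate Real
open Complex

namespace Summit.RiemannHypothesis.RiemannHypothesis.Theorems.WeilCombBohrFejer

open Literature.NumberTheory.LFunctions

/-- **`fejerDivisorPositivity_iff_posDef`** (registered helper of crux stmt-RiemannHypothesis-11229, plan T5e):
`FejerDivisorPositivity ⟺` for every `ε > 0` the comb symbol `x ↦ W(τ_x(φ_ε ⋆ φ̃_ε))` is positive-definite on
`ℝ` (all finite Hermitian node forms at real nodes are `≥ 0`). [folklore] -/
theorem fejerDivisorPositivity_iff_posDef :
    Summit.RiemannHypothesis.RiemannHypothesis.Theorems.FejerDivisorPositivity ↔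
      ∀ ε : ℝ, 0 < ε → ∀ (ι : Type) (I : Finset ι) (x : ι → ℝ) (c : ι → ℂ),
        0 ≤ (∑ i ∈ I, ∑ j ∈ I, c i * conj (c j) *
          weilFunctional (weilTranslate
            (weilConv (fun t : ℝ => (ε : ℂ)⁻¹ * ((expNegInvGlue (1 - (t / ε) ^ 2) : ℝ) : ℂ))
              (weilReflect (fun t : ℝ => (ε : ℂ)⁻¹ * ((expNegInvGlue (1 - (t / ε) ^ 2) : ℝ) : ℂ))))
            (x i - x j))).re := by
  constructor
  · intro hF ε hε ι I x c
    have hS : ∀ p ∈ ({2, 3} : Finset ℕ), p.Prime := by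
      intro p hp
      simp only [Finset.mem_insert, Finset.mem_singleton] at hp
      rcases hp with rfl | rfl <;> norm_num
    have hcard : 1 < ({2, 3} : Finset ℕ).card := by decide
    -- node forms of the symbol at all `{2,3}`-smooth integer nodes, from the faces (reduction with `n₀ = 0`)
    have hT : ∀ T : Finset ℕ, (∀ m ∈ T, m ≠ 0 ∧ m.primeFactors ⊆ ({2, 3} : Finset ℕ)) → ∀ c' : ℕ → ℂ,
        0 ≤ (∑ m ∈ T, ∑ m' ∈ T, c' m * conj (c' m') *
          weilFunctional (weilTranslate
            (weilConv (fun t : ℝ => (ε : ℂ)⁻¹ * ((expNegInvGlue (1 - (t / ε) ^ 2) : ℝ) : ℂ))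
              (weilReflect (fun t : ℝ => (ε : ℂ)⁻¹ * ((expNegInvGlue (1 - (t / ε) ^ 2) : ℝ) : ℂ))))
            (Real.log (m : ℝ) - Real.log (m' : ℝ)))).re :=
      fun T hT' c' => reduction_local
        (fun y : ℝ => weilFunctional (weilTranslate
          (weilConv (fun t : ℝ => (ε : ℂ)⁻¹ * ((expNegInvGlue (1 - (t / ε) ^ 2) : ℝ) : ℂ))
            (weilReflect (fun t : ℝ => (ε : ℂ)⁻¹ * ((expNegInvGlue (1 - (t / ε) ^ 2) : ℝ) : ℂ)))) y))
        {2, 3} hS 0 (fun n _ θ => hF ε hε {2, 3} hS n θ) T hT' c'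
    -- the kernel is passed EXPLICITLY (higher-order unification would otherwise unfold `weilFunctional`)
    exact psd_of_psd_smooth
      (w := fun y : ℝ => weilFunctional (weilTranslate
        (weilConv (fun t : ℝ => (ε : ℂ)⁻¹ * ((expNegInvGlue (1 - (t / ε) ^ 2) : ℝ) : ℂ))
          (weilReflect (fun t : ℝ => (ε : ℂ)⁻¹ * ((expNegInvGlue (1 - (t / ε) ^ 2) : ℝ) : ℂ)))) y))
      (continuous_symbol ε) hS hcard hT I x c
  · intro h ε hε S hS n θ
    exact h ε hε ℕ ((∏ p ∈ S, p ^ n).divisors) (fun d => Real.log (d : ℝ))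
      (fun d => Complex.exp (I * ((∑ p ∈ S, θ p * (d.factorization p : ℝ) : ℝ) : ℂ)))

end Summit.RiemannHypothesis.RiemannHypothesis.Theorems.WeilCombBohrFejer

end
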